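import Summits.BirchSwinnertonDyer.BirchSwinnertonDyer.Theorems.BiquadraticEisensteinDescentEisensteinHeartFlatCMInertBadKPrimeFrameCMSubfield
import Literature.NumberTheory.EllipticCurves.KatzPAdicLFunctionCMFieldLocalDataUnramifiedProofs
import Literature.NumberTheory.EllipticCurves.KatzPAdicLFunctionCMFieldLocalDataDyadicUnitProofs
import Literature.NumberTheory.QuadraticFields.HeegnerCondition
import Summits.BirchSwinnertonDyer.BirchSwinnertonDyer.Theorems.BiquadraticEisensteinDescentEisensteinHeartFlatCMInertBadKPrimeBranchBadPrimes
import HarnessLib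

set_option linter.dupNamespace false -- `Summit.BirchSwinnertonDyer.BirchSwinnertonDyer.Theorems.…` (summit = sub)
set_option autoImplicit false

/-!
# Crux `EisensteinHeartFlatCMInertBadKPrime` (stmt-BirchSwinnertonDyer-21341), line `hsieh-lambda`, layer 2 —
# FRAME: `L / ℚ⟮x⟯` (i.e. `L / K_CM`) is UNRAMIFIED above every prime `ℓ ∤ d_{K′}`; (hψbad) at the frame with no binder left

Route `BiquadraticEisensteinDescent` (cell `pub/bsd-wall`, width seat `bsd-wall-cm-bed-w1`; lead `bsd-wall-cm-bed-p1`,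
skeleton `Cruxes/EisensteinHeartFlatCMInertBadKPrime/Lines/hsieh_lambda.lean` v2.1). THEOREMS ONLY (no definition, no named
fact, no `sorry`); supports stmt-BirchSwinnertonDyer-21341 as a helper; nothing about the crux's input (stub `V4`) or any
case of BSD is asserted. Sequel of `…FrameCMSubfield` (`K₁ := ℚ⟮x⟯ ⊆ L`) and `…BranchBadPrimes` (hψbad modulo `hunr`).

## What is discharged

`…BranchBadPrimes.not_isUnramifiedAt_compRelNorm_of_bad` proves the side condition (hψbad) of hypothesis (L) modulo the binder
`hunr : ∀ ℓ bad, ∀ v ∋ ℓ of K₁, Algebra.IsUnramifiedIn (𝓞 L) v.asIdeal` («`L/K_CM` is unramified above the bad primes»). Here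
`hunr` is PROVED at the frame: `L = K′(x) = ℚ⟮x⟯(δ_L)` with `δ = √d_{K′} ∈ 𝓞 K′` (`Quadratic.exists_sq_eq_discr`), so `L/ℚ⟮x⟯` is a
Kummer extension generated by a square root of the DISCRIMINANT `D = d_{K′}` and is unramified above every `ℓ ∤ D` — for odd `ℓ`
by the tree's `isUnramifiedAt_of_sq_eq_of_not_mem` (Kummer off `2D`), for `ℓ = 2 ∤ D` (`D ≡ 1 mod 4`, `discr_emod_four`) by
`isUnramifiedAt_of_sq_eq_of_one_mod_four` (generator `(1 + δ)/2`); under the Heegner hypothesis every bad `ℓ` of `W` splits in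
`K′`, hence `ℓ ∤ d_{K′}` (`not_dvd_discr_of_satisfiesHeegnerHypothesis`, kept as the binder `hbad`).

* §1 (any base field) `natDegree_minpoly_eq_two_of_sq_eq`, `adjoin_eq_top_of_sq_eq` (`E = F(z)` for `z ∉ F`, `z² ∈ F`,
  `[E : F] = 2`);
* §2 `algebraMap_not_mem_adjoin` (`δ_L ∉ ℚ⟮x⟯`), `algebraMap_not_mem_range_rat`, `adjoin_algebraMap_eq_top`
  (`Algebra.adjoin ℚ⟮x⟯ {δ_L} = ⊤`);
* §3 `isUnramifiedAt_of_not_dvd`, `isUnramifiedIn_of_not_dvd`, **`hunr_of_frame`** (the binder, literally);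
* §4 **`hψbad_of_frame`** — (hψbad) for ANY `ψ` on `ℚ⟮x⟯` with Deuring (iii), no unramifiedness hypothesis left.

References: [NeukirchANT1999] Ch. III §2; [Marcus2018] Ch. 2 Thm. 1; [BombieriGubler2006] App. B.2; [GrossLMS1991] §1.
-/

noncomputable section

open scoped Classical NumberField IntermediateField
open NumberField IsDedekindDomain Module Polynomial IntermediateField

namespace Summit.BirchSwinnertonDyer.BirchSwinnertonDyer.Theorems.BiquadraticEisensteinDescentEisensteinHeartFlatCMInertBadKPrimeBranchUnramified

open Literature.NumberTheory.EllipticCurves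
open Summit.BirchSwinnertonDyer.BirchSwinnertonDyer.Theorems.BiquadraticEisensteinDescentEisensteinHeartFlatCMInertBadKPrimeFrameCMSubfield

variable {K L : Type} [Field K] [NumberField K] [Field L] [NumberField L] [Algebra K L]

/-! ### §1 Square-root generators over an arbitrary base field -/

section General

variable {F E : Type*} [Field F] [Field E] [Algebra F E]

/-- **The minimal polynomial of `z ∉ F` with `z² = c ∈ F` has degree `2`.** [cite: Marcus2018, Ch. 2 Thm. 1] -/
theorem natDegree_minpoly_eq_two_of_sq_eq {z : E} {c : F} (hz : z ^ 2 = algebraMap F E c)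
    (hzF : z ∉ Set.range (algebraMap F E)) : (minpoly F z).natDegree = 2 := by
  have hint : IsIntegral F z := IsIntegral.of_pow two_pos (by rw [hz]; exact isIntegral_algebraMap)
  have hle : (minpoly F z).natDegree ≤ 2 := by
    have hp : (X ^ 2 - C c : F[X]) ≠ 0 := (monic_X_pow_sub_C _ two_ne_zero).ne_zero
    have hroot : aeval z (X ^ 2 - C c : F[X]) = 0 := by simp [hz]
    have h := minpoly.degree_le_of_ne_zero F z hp hroot
    rw [degree_eq_natDegree (minpoly.ne_zero hint), degree_eq_natDegree hp, natDegree_X_pow_sub_C] at h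
    exact_mod_cast h
  have hpos : 0 < (minpoly F z).natDegree := minpoly.natDegree_pos hint
  have hne1 : (minpoly F z).natDegree ≠ 1 := by
    intro h1
    have hdeg : (minpoly F z).degree = 1 := by rw [degree_eq_natDegree (minpoly.ne_zero hint), h1]; rfl
    exact hzF (Set.mem_range.mpr (RingHom.mem_range.mp ((minpoly.degree_eq_one_iff).mp hdeg)))
  omega

/-- **`E = F(z)` as an `F`-algebra** (`Algebra.adjoin F {z} = ⊤`) when `[E : F] = 2`, `z ∉ F`, `z² = c ∈ F` — the `hgen` binder of
the tree's Kummer lemmas `isUnramifiedAt_of_sq_eq_of_not_mem` / `…_of_one_mod_four`. [cite: Marcus2018, Ch. 2 Thm. 1] -/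
theorem adjoin_eq_top_of_sq_eq [FiniteDimensional F E] (h2 : finrank F E = 2) {z : E} {c : F}
    (hz : z ^ 2 = algebraMap F E c) (hzF : z ∉ Set.range (algebraMap F E)) : Algebra.adjoin F {z} = ⊤ := by
  have hint : IsIntegral F z := IsIntegral.of_pow two_pos (by rw [hz]; exact isIntegral_algebraMap)
  have htop : F⟮z⟯ = ⊤ := by
    rw [Field.primitive_element_iff_minpoly_natDegree_eq, natDegree_minpoly_eq_two_of_sq_eq hz hzF, h2]
  rw [← adjoin_simple_toSubalgebra_of_isAlgebraic hint.isAlgebraic, htop, IntermediateField.top_toSubalgebra]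

end General

/-! ### §2 `δ = √d_{K′} ∉ ℚ⟮x⟯` and `L = ℚ⟮x⟯(δ)` -/

/-- **An element `δ_L ∉ ℚ` of the image of `K` (`δ² = D`) is NOT in `ℚ⟮x⟯`** when `x ∉ K` (`x² = d`): otherwise
`ℚ⟮δ_L⟯ = ℚ⟮x⟯` by degrees and `x` would lie in the image of `K`. [cite: Marcus2018, Ch. 2 Thm. 1] -/
theorem algebraMap_not_mem_adjoin {x : L} {d : ℤ} (hx : x ^ 2 = (d : L)) (hxK : x ∉ Set.range (algebraMap K L))
    {δ : K} {D : ℤ} (hδ : δ ^ 2 = (D : K)) (hδQ : algebraMap K L δ ∉ Set.range (algebraMap ℚ L)) :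
    algebraMap K L δ ∉ ℚ⟮x⟯ := by
  intro hmem
  have hδL : (algebraMap K L δ) ^ 2 = (D : L) := by rw [← map_pow, hδ, map_intCast]
  have hle : ℚ⟮algebraMap K L δ⟯ ≤ ℚ⟮x⟯ := adjoin_simple_le_iff.mpr hmem
  have heq : ℚ⟮algebraMap K L δ⟯ = ℚ⟮x⟯ :=
    eq_of_le_of_finrank_eq hle (by rw [finrank_adjoin_eq_two hδL hδQ, finrank_adjoin_eq_two hx (not_mem_range_rat hxK)])
  have hxmem : x ∈ ℚ⟮algebraMap K L δ⟯ := by rw [heq]; exact mem_adjoin_simple_self ℚ x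
  -- `ℚ⟮δ_L⟯` lies in the image of `K`
  have hsub : ℚ⟮algebraMap K L δ⟯ ≤ (IsScalarTower.toAlgHom ℚ K L).fieldRange :=
    adjoin_simple_le_iff.mpr ⟨δ, rfl⟩
  obtain ⟨k, hk⟩ := AlgHom.mem_fieldRange.mp (hsub hxmem)
  exact hxK ⟨k, hk⟩

omit [NumberField K] in
/-- `δ_L ∉ ℚ` inside `L` when `δ² = D < 0`. [folklore] -/
theorem algebraMap_not_mem_range_rat {δ : K} {D : ℤ} (hδ : δ ^ 2 = (D : K)) (hD : D < 0) :
    algebraMap K L δ ∉ Set.range (algebraMap ℚ L) := by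
  rintro ⟨q, hq⟩
  have h1 : (algebraMap ℚ L) (q ^ 2) = (algebraMap ℚ L) (D : ℚ) := by
    rw [map_pow, hq, ← map_pow, hδ, map_intCast, map_intCast]
  have h2 : q ^ 2 = (D : ℚ) := (algebraMap ℚ L).injective h1
  have h3 : (0 : ℚ) ≤ q ^ 2 := sq_nonneg q
  have h4 : ((D : ℤ) : ℚ) < 0 := by exact_mod_cast hD
  linarith

/-- **`L = ℚ⟮x⟯(δ_L)`**: `Algebra.adjoin ℚ⟮x⟯ {δ_L} = ⊤` for `δ ∈ K`, `δ² = D < 0`, when `K` is imaginary quadratic, `[L : K] = 2`,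
`x ∉ K`, `x² = d`. [cite: Marcus2018, Ch. 2 Thm. 1] -/
theorem adjoin_algebraMap_eq_top (hK : IsImaginaryQuadratic K) (h2 : finrank K L = 2) {x : L} {d : ℤ}
    (hx : x ^ 2 = (d : L)) (hxK : x ∉ Set.range (algebraMap K L)) {δ : K} {D : ℤ} (hδ : δ ^ 2 = (D : K)) (hD : D < 0) :
    Algebra.adjoin ℚ⟮x⟯ {algebraMap K L δ} = ⊤ := by
  have hxQ := not_mem_range_rat hxK
  refine adjoin_eq_top_of_sq_eq (finrank_adjoin_top_eq_two hK h2 hx hxQ) (c := ((D : ℤ) : ℚ⟮x⟯)) ?_ ?_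
  · rw [← map_pow, hδ, map_intCast, map_intCast]
  · rintro ⟨y, hy⟩
    exact algebraMap_not_mem_adjoin hx hxK hδ (algebraMap_not_mem_range_rat hδ hD) (by rw [← hy]; exact y.2)

/-! ### §3 `L/ℚ⟮x⟯` is unramified above every `ℓ ∤ D` (`δ² = D = d_{K′}`) -/

/-- **Every prime of `L` above a prime `ℓ ∤ D` is unramified over `ℚ⟮x⟯`**, where `L = ℚ⟮x⟯(δ_L)`, `δ ∈ K`, `δ² = D < 0`,
`D ≡ 0` or `1 (mod 4)` (a discriminant): for odd `ℓ` Kummer theory off `2D` (the tree's `isUnramifiedAt_of_sq_eq_of_not_mem`),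
for `ℓ = 2 ∤ D` (so `D ≡ 1 (mod 4)`) the dyadic unit lemma `isUnramifiedAt_of_sq_eq_of_one_mod_four` (generator `(1 + δ)/2`).
[cite: NeukirchANT1999, Ch. III §2 (Dedekind: `ℓ ∤ d` unramified)] [cite: BombieriGubler2006, App. B.2.6] -/
theorem isUnramifiedAt_of_not_dvd (hK : IsImaginaryQuadratic K) (h2 : finrank K L = 2) {x : L} {d : ℤ}
    (hx : x ^ 2 = (d : L)) (hxK : x ∉ Set.range (algebraMap K L)) {δ : K} {D : ℤ} (hδ : δ ^ 2 = (D : K)) (hD : D < 0)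
    (hD4 : D % 4 = 0 ∨ D % 4 = 1) {ℓ : ℕ} (hℓ : ℓ.Prime) (hℓD : ¬ (ℓ : ℤ) ∣ D) (w : HeightOneSpectrum (𝓞 L))
    (hw : (ℓ : 𝓞 L) ∈ w.asIdeal) : Algebra.IsUnramifiedAt (𝓞 ℚ⟮x⟯) w.asIdeal := by
  have hgen := adjoin_algebraMap_eq_top hK h2 hx hxK hδ hD
  have hδL : (algebraMap K L δ) ^ 2 = (D : L) := by rw [← map_pow, hδ, map_intCast]
  by_cases h2ℓ : ℓ = 2
  · subst h2ℓ
    have hD1 : D % 4 = 1 := by omega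
    exact isUnramifiedAt_of_sq_eq_of_one_mod_four L hgen hδL hD1 w hw
  · have hodd : ¬ (ℓ : ℤ) ∣ 2 * D := by
      intro h
      rcases (Nat.prime_iff_prime_int.mp hℓ).dvd_or_dvd h with h' | h'
      · have : (ℓ : ℤ) ∣ (2 : ℕ) := by exact_mod_cast h'
        have h2' : ℓ ∣ 2 := by exact_mod_cast this
        exact h2ℓ ((Nat.prime_dvd_prime_iff_eq hℓ Nat.prime_two).mp h2')
      · exact hℓD h'
    refine isUnramifiedAt_of_sq_eq_of_not_mem L hgen (t := ((D : ℤ) : 𝓞 ℚ⟮x⟯)) ?_ w ?_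
    · rw [hδL]; simp
    · have h := intCast_not_mem_of_not_dvd hℓ w hw hodd
      rw [show (2 * ((D : ℤ) : 𝓞 ℚ⟮x⟯) : 𝓞 ℚ⟮x⟯) = ((2 * D : ℤ) : 𝓞 ℚ⟮x⟯) by push_cast; ring,
        intCast_mem_under_iff]
      exact h

/-- **`hunr` at the frame, prime by prime**: for `ℓ ∤ D` and a prime `v ∋ ℓ` of `K₁ = ℚ⟮x⟯`, `v` is unramified in `L`
(`Algebra.IsUnramifiedIn (𝓞 L) v.asIdeal`). [cite: NeukirchANT1999, Ch. III §2] -/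
theorem isUnramifiedIn_of_not_dvd (hK : IsImaginaryQuadratic K) (h2 : finrank K L = 2) {x : L} {d : ℤ}
    (hx : x ^ 2 = (d : L)) (hxK : x ∉ Set.range (algebraMap K L)) {δ : K} {D : ℤ} (hδ : δ ^ 2 = (D : K)) (hD : D < 0)
    (hD4 : D % 4 = 0 ∨ D % 4 = 1) {ℓ : ℕ} (hℓ : ℓ.Prime) (hℓD : ¬ (ℓ : ℤ) ∣ D) (v : HeightOneSpectrum (𝓞 ℚ⟮x⟯))
    (hv : (ℓ : 𝓞 ℚ⟮x⟯) ∈ v.asIdeal) : Algebra.IsUnramifiedIn (𝓞 L) v.asIdeal := by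
  intro P hP hlies
  have hℓP : ((ℓ : ℕ) : 𝓞 L) ∈ P := by
    have hmem : ((ℓ : ℕ) : 𝓞 ℚ⟮x⟯) ∈ P.under (𝓞 ℚ⟮x⟯) := by rw [← hlies.over]; exact hv
    rw [Ideal.mem_comap, map_natCast] at hmem
    exact hmem
  have hne : P ≠ ⊥ := fun h ↦ by
    rw [h] at hℓP
    exact (Nat.cast_ne_zero.mpr hℓ.ne_zero : ((ℓ : ℕ) : 𝓞 L) ≠ 0) ((Submodule.mem_bot _).mp hℓP)
  exact isUnramifiedAt_of_not_dvd hK h2 hx hxK hδ hD hD4 hℓ hℓD ⟨P, hP, hne⟩ hℓP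

/-- **`hunr` — the binder of `…BranchBadPrimes.not_isUnramifiedAt_compRelNorm_of_bad` at the frame `K₁ = ℚ⟮x⟯`.** For the
Heegner field `K = K′` (imaginary quadratic; `δ ∈ 𝓞 K′` with `δ² = d_{K′}`, `Quadratic.exists_sq_eq_discr`), `L ⊇ K′` quadratic with
`x² = d`, `x ∉ K′`, and a curve `W` all of whose BAD primes are prime to `d_{K′}` (under the Heegner hypothesis every bad `ℓ`
splits in `K′`: `not_dvd_discr_of_satisfiesHeegnerHypothesis`): for every bad `ℓ` and every prime `v ∋ ℓ` of `ℚ⟮x⟯`, `v` is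
unramified in `L`. [cite: NeukirchANT1999, Ch. III §2] [cite: GrossLMS1991, §1 (p. 235)] -/
theorem hunr_of_frame (hK : IsImaginaryQuadratic K) (h2 : finrank K L = 2) {x : L} {d : ℤ} (hx : x ^ 2 = (d : L))
    (hxK : x ∉ Set.range (algebraMap K L)) {δ : 𝓞 K} (hδ : δ ^ 2 = (NumberField.discr K : 𝓞 K))
    (W : WeierstrassCurve ℚ)
    (hbad : ∀ (ℓ : ℕ) [Fact ℓ.Prime], ¬ W.HasGoodReductionAtPrime ℓ → ¬ (ℓ : ℤ) ∣ NumberField.discr K) :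
    ∀ (ℓ : ℕ) [Fact ℓ.Prime], ¬ W.HasGoodReductionAtPrime ℓ →
      ∀ v : HeightOneSpectrum (𝓞 ℚ⟮x⟯), (ℓ : 𝓞 ℚ⟮x⟯) ∈ v.asIdeal → Algebra.IsUnramifiedIn (𝓞 L) v.asIdeal := by
  intro ℓ hℓ hℓbad v hv
  have hδ' : (δ : K) ^ 2 = (NumberField.discr K : K) := by
    have := congrArg (fun z : 𝓞 K ↦ (z : K)) hδ
    simpa using this
  exact isUnramifiedIn_of_not_dvd hK h2 hx hxK hδ' hK.discr_neg
    (Literature.NumberTheory.QuadraticFields.Quadratic.discr_emod_four hK.1) hℓ.out (hbad ℓ hℓbad) v hv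

/-! ### §4 (hψbad) at the frame `K₁ = ℚ⟮x⟯`, unconditionally in `L/K₁` -/

/-- **(hψbad) AT THE FRAME.** For the Heegner field `K = K′` (imaginary quadratic, `δ ∈ 𝓞 K′`, `δ² = d_{K′}`), the biquadratic
`L ⊇ K′` (`[L : K′] = 2`) with `x ∈ L`, `x² = cmFieldDiscr W.j`, `x ∉ K′`, the CM field REALISED AS `K₁ := ℚ⟮x⟯ ⊆ L`
(`…FrameCMSubfield.isCMFieldOfJ_adjoin`), `W/ℚ` with `W.j ∈ maximalCMJInvariants` all of whose bad primes are prime to `d_{K′}`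
(Heegner), and ANY Hecke character `ψ` of `ℚ⟮x⟯` with Deuring's clause (iii): `ψ ∘ N_{L/ℚ⟮x⟯}` is ramified at every prime of `L`
above every bad prime — the binder `hψbad` of `…DeuringOverKPrime.polynomial_identity` / `…KatzHsiehLValueCM`, now with NO
unramifiedness hypothesis left (`…BranchBadPrimes.not_isUnramifiedAt_compRelNorm_of_bad` + `hunr_of_frame`).
[cite: SilvermanATAEC1994, Ch. II Thm. 9.2 (b) (PDF p. 165)] [cite: Childress2009, Ch. 4 §5 Lemma 5.3 (a) (PDF p. 95)] -/
theorem hψbad_of_frame (hK : IsImaginaryQuadratic K) (h2 : finrank K L = 2) (W : WeierstrassCurve ℚ) [W.IsElliptic]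
    (hj : W.j ∈ maximalCMJInvariants) {x : L} (hx : x ^ 2 = (cmFieldDiscr W.j : L))
    (hxK : x ∉ Set.range (algebraMap K L)) {δ : 𝓞 K} (hδ : δ ^ 2 = (NumberField.discr K : 𝓞 K))
    (hbad : ∀ (ℓ : ℕ) [Fact ℓ.Prime], ¬ W.HasGoodReductionAtPrime ℓ → ¬ (ℓ : ℤ) ∣ NumberField.discr K)
    [IsGalois ℚ⟮x⟯ L] {ψ : Literature.NumberTheory.GaloisRepresentations.HeckeCharacter ℚ⟮x⟯}
    (hψ : ∀ v : HeightOneSpectrum (𝓞 ℚ⟮x⟯), ψ.IsUnramifiedAt v ↔ (W.baseChange ℚ⟮x⟯).HasGoodReductionAt v) :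
    ∀ (ℓ : ℕ) [Fact ℓ.Prime], ¬ W.HasGoodReductionAtPrime ℓ →
      ∀ w : HeightOneSpectrum (𝓞 L), (ℓ : 𝓞 L) ∈ w.asIdeal → ¬ (ψ.compRelNorm L).IsUnramifiedAt w :=
  Summit.BirchSwinnertonDyer.BirchSwinnertonDyer.Theorems.BiquadraticEisensteinDescentEisensteinHeartFlatCMInertBadKPrimeBranchBadPrimes.not_isUnramifiedAt_compRelNorm_of_bad
    W hj (isCMFieldOfJ_adjoin hx (not_mem_range_rat hxK)) hψ (hunr_of_frame hK h2 hx hxK hδ W hbad)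

end Summit.BirchSwinnertonDyer.BirchSwinnertonDyer.Theorems.BiquadraticEisensteinDescentEisensteinHeartFlatCMInertBadKPrimeBranchUnramified

end
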